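import Mathlib.LinearAlgebra.Matrix.Block
import Literature.NumberTheory.GaloisRepresentations.GaloisRep
import Literature.NumberTheory.GaloisRepresentations.LocalClassFieldTheory
import Literature.NumberTheory.Automorphic.AdicCompletionLocalField
import HarnessLib

/-!
# `P`-ordinary Galois representations at a place above `ℓ` (parabolic / `μ`-ordinary shape)

Trunk `Literature/NumberTheory/GaloisRepresentations`.  Let `L` be a non-archimedean local field
(intended: `L = K_v`, `v ∣ ℓ`, a finite extension of `ℚ_ℓ`), `A` a commutative coefficient ring
(intended: `ℚ̄_ℓ = PadicAlgCl ℓ`, or a finite `E/ℚ_ℓ` containing the images of all embeddings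
`L ↪ ℚ̄_ℓ`) and `ρ : Γ_L → GL_n(A)` a framed representation.

**The printed notion (Borel case).**  Barnet-Lamb–Gee–Geraghty–Taylor, *Potential automorphy and
change of weight*, §1.4 (following Geraghty, *Modularity lifting theorems for ordinary Galois
representations*): `ρ : G_K → GL_n(ℚ̄_l)` is *ordinary* if (1) there is a `G_K`-invariant
decreasing filtration of `ℚ̄_lⁿ` with one-dimensional graded pieces on which `G_K` acts by
characters `χ_1, …, χ_n`, and (2) there are integers `b_{τ,i}` (`τ ∈ Hom_{ℚ_l}(K, ℚ̄_l)`) and an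
open subgroup `U ⊂ K^×` such that `(χ_i ∘ Art_K)|_U (α) = ∏_τ τ(α)^{b_{τ,i}}`, together with the
regularity condition `b_{τ,1} < ⋯ < b_{τ,n}`; then `ρ` is de Rham with `HT_τ(ρ) = {-b_{τ,i}}`
(`Art_K` normalised to send uniformisers to geometric Frobenius elements, `HT_τ(ε_l) = {-1}`).
[BarnetlambEtAl2014, §1.4]

**The parabolic (`P`-ordinary, `μ`-ordinary) shape.**  Boxer–Calegari–Gee–Pilloni, *Abelian
surfaces over totally real fields are potentially modular*, §7.3, first Definition
("`p`-distinguished weight `2` ordinary"): `ρ : G_{F_v} → GSp_4` is conjugate to a *block* upper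
triangular representation whose diagonal `2 × 2` blocks are `diag(λ_α, λ_β)` (unramified) and
`diag(ε⁻¹λ_β⁻¹, ε⁻¹λ_α⁻¹)`: blocks of sizes `(2, 2)` acting on inertia through the scalar
characters `1` and `ε⁻¹`, i.e. through `∏_τ (τ ∘ Art⁻¹)^{-w}` with parallel labelled Hodge–Tate
weights `w = 0` and `w = 1`. [BoxerEtAl2021, §7.3]

This file defines the common generalisation asked for by the definition item
`defn-FramedGaloisRep.IsPOrdinaryAt` (route `CubicSurfaceE6Transport`, crux
`PolarisedLiftingRank5`, where the `μ`-ordinary shape at a ramified prime of `GU(4,1)` has blocks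
`(1,3,1)` with *non-parallel* labelled weights):

* `LocalArtinData.weightCharacter d emb e : W_L →* Aˣ` — for a local Artin datum `d`
  (`Literature…LocalArtinData`: `artin : W_L →* Lˣ`, geometric Frobenius ↦ uniformiser, i.e. the
  inverse of BLGGT's `Art_L` on the Weil group), a finite family of embeddings `emb : ι → (L →+* A)`
  and exponents `e : ι → ℤ`: the algebraic character `x ↦ ∏_i (emb i)(artin x)^{e i}`.  On the
  inertia group `I_L ⊆ W_L` (`artin(I_L) = 𝒪_Lˣ`) this is `u ↦ ∏_τ τ(u)^{e_τ}` — the right-hand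
  side of BLGGT's condition (2), pulled back along `Art_L⁻¹`.
* `FramedGaloisRep.IsPOrdinary ρ d blk emb w` — the **local** predicate.  Data: a block labelling
  `blk : Fin n → α` into a linear order `α` (the blocks are the fibres of `blk`, ordered by `α`; a
  composition `n = n₁ + ⋯ + n_r` is `α = Fin r` with `blk` monotone, and up to a permutation of the
  frame every `blk` is of this form) and labelled Hodge–Tate weights `w : α → ι → ℤ` per block and
  per embedding.  Condition: there are a frame `Q ∈ GL_n(A)` and an open subgroup `U ≤ Γ_L` such
  that every `Q⁻¹ ρ(σ) Q` is block upper triangular for `blk` (Mathlib `Matrix.BlockTriangular`: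
  entries `(i,j)` with `blk j < blk i` vanish, so the fibre of the least label spans a
  subrepresentation and labels increase towards the quotient), and for every label `k` and every
  `x` in the inertia group with `x ∈ U`, the `k`-th diagonal block of `Q⁻¹ ρ(x) Q`
  (Mathlib `Matrix.toSquareBlock`) is the *scalar* matrix `∏_i (emb i)(artin x)^{-(w k i)}`.
  Tree convention (as in `Literature.NumberTheory.Automorphic.InfinityType`, BLGGT): the cyclotomic
  character has Hodge–Tate weight `-1`, so a block of parallel weight `w` acts on an open subgroup
  of inertia through `ε^{-w}`, and BLGGT's `b_{τ,i}` is `-w`.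
* `FramedGaloisRep.IsPOrdinaryAt ρ v d blk emb w` — the **global** predicate for a number field
  `K`, a finite place `v` and `ρ : Γ_K → GL_n(A)`: `ρ.toLocal v` is `P`-ordinary of type
  `(blk, w)` (local field structure on `K_v = v.adicCompletion K` from
  `Literature.NumberTheory.Automorphic.AdicCompletionLocalField`).  Intended for `v ∣ ℓ` with `A` an
  `ℓ`-adic coefficient ring and `emb` an enumeration of `Hom_{ℚ_ℓ}(K_v, ℚ̄_ℓ)`.

API (all proved): unfolding lemmas (`isPOrdinary_iff`, `isPOrdinaryAt_iff`), frame-change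
invariance (`isPOrdinary_conj_iff`, `isPOrdinaryAt_conj_iff`), shrinking the open subgroup
(`IsPOrdinary.exists_le`), the values of `weightCharacter` (`weightCharacter_apply`,
`val_weightCharacter_apply`, `weightCharacter_zero`, `weightCharacter_add`, `weightCharacter_neg`),
and the sanity check that the trivial representation is `P`-ordinary of weight `0` for every block
labelling (`isPOrdinary_one`, `isPOrdinaryAt_one`).

## Faithfulness notes

* For `α = Fin n`, `blk = id` (Borel) and `A = ℚ̄_ℓ` the predicate is BLGGT's (1)–(2) verbatim up to
  the dictionary: filtration ↔ frame `Q` (the fibre of the least label spans BLGGT's `Fil^n = gr^n`,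
  the subobject; the greatest label gives the top quotient `gr^1`), `U ⊂ K^×` open ↔ open subgroup
  of `Γ_L` meeting inertia (`Art_L` is a homeomorphism `𝒪_Lˣ ≅ I(L^ab/L)` and one may shrink `U`
  into `𝒪_Lˣ`), `b_{τ,i} = -w`.  BLGGT's regularity clause `b_{τ,1} < ⋯ < b_{τ,n}` (weights
  strictly increasing with the label, for every `τ`) is **not** part of `IsPOrdinary`: the
  `μ`-ordinary types it is requested for (e.g. blocks `(1,3,1)` with weights `(0,0), (1,0), (1,1)`
  at the two embeddings of a quadratic `L`) violate it embedding by embedding.  "ss-ordinary"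
  (`U = 𝒪_K^×`, i.e. the condition on all of inertia) and "cr-ordinary" are not defined here.
* BCGP's "`p`-distinguished weight `2` ordinary" representations (`L = ℚ_p`) are `P`-ordinary of
  type (blocks `(2,2)`, parallel weights `0, 1`) in the present sense (any `U`); the converse needs
  in addition the condition on all of inertia, the splitting `λ_α ⊕ λ_β` of the blocks, the
  symplectic constraint and `ᾱ ≠ β̄`.  No distinguishedness clause is included here (BCGP's lives
  *inside* a Levi block and is a condition on the residual representation); users conjoin it
  separately.
* The local Artin map enters as the datum `d : LocalArtinData L`, exactly as in the accepted
  `LocalLanglandsDatum`, `IsLocalLanglandsGL`, `LocalConstants`: the tree has local class field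
  theory as a hypothesis structure (inhabited: `nonempty_localArtinData_holds`), whose axioms do
  not single out the canonical Artin map; the intended `d` is the canonical one, and statements
  should quantify over `d` consistently with those files.
* Blocks of size `> 1` are required to act on an open subgroup of inertia through a *scalar*
  algebraic character (BCGP's shape: each diagonal block is a twist of a representation that is
  potentially unramified, i.e. finite on inertia).

## Mathlib / Literature search

Mathlib has `Matrix.BlockTriangular`, `Matrix.toSquareBlock`, `Matrix.GeneralLinearGroup`,
`Units.map`, but no ordinarity notion for Galois representations (grep `[Oo]rdinary` over
`Mathlib/NumberTheory`, `Mathlib/RepresentationTheory`: nothing).  In the tree,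
`OrdinaryGaloisRep.lean` has the rank-two, cyclotomic, regular-weight `IsOrdinaryOfWeightAt`
(Skinner–Wiles shape), which cannot express embedding-labelled weights or blocks; its frame
convention `Q⁻¹ ρ Q` is followed here.

## References

* T. Barnet-Lamb, T. Gee, D. Geraghty, R. Taylor, *Potential automorphy and change of weight*,
  Ann. of Math. 179 (2014), §1.4 ("Local theory: `l = p`", definition of ordinary / ss-ordinary /
  cr-ordinary) and the notation section (`Art_K`, `HT_τ(ε_l) = {-1}`). [BarnetlambEtAl2014]
* G. Boxer, F. Calegari, T. Gee, V. Pilloni, *Abelian surfaces over totally real fields are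
  potentially modular*, Publ. Math. IHÉS 134 (2021), §7.3, first Definition (`p`-distinguished
  weight `2` ordinary). [BoxerEtAl2021]
* D. Geraghty, *Modularity lifting theorems for ordinary Galois representations*, Math. Ann. 373
  (2019) (the ordinary deformation condition; cited through BLGGT §1.4, §2.3).
-/

noncomputable section

open scoped NumberField MatrixGroups
open Field IsDedekindDomain

namespace Literature.NumberTheory.GaloisRepresentations

/-! ### The algebraic weight character of the Weil group attached to an Artin datum -/

section WeightCharacter

variable {L : Type*} [Field L] [ValuativeRel L] [TopologicalSpace L] [IsNonarchimedeanLocalField L]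
variable {A : Type*} [CommRing A]

namespace LocalArtinData

/-- The **algebraic weight character** of the Weil group `W_L` attached to a local Artin datum
`d` (`artin : W_L →* Lˣ`), a finite family of ring embeddings `emb : ι → (L →+* A)` and integer
exponents `e : ι → ℤ`: `x ↦ ∏_i (emb i)(artin x) ^ (e i) ∈ Aˣ`.  On the inertia group
(`artin(I_L) = 𝒪_Lˣ`, `LocalArtinData.image_inertia`) it is `u ↦ ∏_τ τ(u)^{e_τ}`, the character
`∏_τ τ^{b_τ} ∘ Art_L⁻¹` of BLGGT's ordinarity condition (`Art_L⁻¹ = artin` on `W_L`).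
[cite: BarnetlambEtAl2014, §1.4 (definition of ordinary, condition on `χ_i ∘ Art_K`)] -/
def weightCharacter (d : LocalArtinData L) {ι : Type*} [Fintype ι] (emb : ι → L →+* A)
    (e : ι → ℤ) : WeilGroup L →* Aˣ where
  toFun x := ∏ i, Units.map (emb i : L →* A) (d.artin x) ^ e i
  map_one' := by simp
  map_mul' x y := by
    simp only [map_mul, mul_zpow, Finset.prod_mul_distrib]

variable (d : LocalArtinData L) {ι : Type*} [Fintype ι] (emb : ι → L →+* A)

/-- Unfolding lemma for `weightCharacter`. [folklore] -/
@[simp] lemma weightCharacter_apply (e : ι → ℤ) (x : WeilGroup L) :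
    d.weightCharacter emb e x = ∏ i, Units.map (emb i : L →* A) (d.artin x) ^ e i := rfl

/-- The value of `weightCharacter` in `A`: `∏_i ((emb i)(artin x))^(e i)` computed in `Aˣ`. [folklore] -/
lemma val_weightCharacter_apply (e : ι → ℤ) (x : WeilGroup L) :
    ((d.weightCharacter emb e x : Aˣ) : A) =
      ∏ i, (((Units.map (emb i : L →* A) (d.artin x)) ^ e i : Aˣ) : A) := by
  rw [weightCharacter_apply, Units.coe_prod]

/-- With all exponents `0` the weight character is trivial. [folklore] -/
@[simp] lemma weightCharacter_zero : d.weightCharacter emb (0 : ι → ℤ) = 1 := by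
  ext x
  simp

/-- Exponents add: `weightCharacter (e + e') = weightCharacter e * weightCharacter e'`. [folklore] -/
lemma weightCharacter_add (e e' : ι → ℤ) :
    d.weightCharacter emb (e + e') = d.weightCharacter emb e * d.weightCharacter emb e' := by
  ext x
  simp [zpow_add, Finset.prod_mul_distrib]

/-- Negating the exponents inverts the weight character. [folklore] -/
lemma weightCharacter_neg (e : ι → ℤ) :
    d.weightCharacter emb (-e) = (d.weightCharacter emb e)⁻¹ := by
  ext x
  simp [Finset.prod_inv_distrib]

end LocalArtinData

end WeightCharacter

/-! ### `P`-ordinary representations of a local Galois group -/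

section Local

variable {L : Type*} [Field L] [ValuativeRel L] [TopologicalSpace L] [IsNonarchimedeanLocalField L]
variable {A : Type*} [CommRing A] [TopologicalSpace A]
variable {n : ℕ} {α : Type*} [LinearOrder α] {ι : Type*} [Fintype ι]

namespace FramedGaloisRep

/-- **`P`-ordinary (parabolic-ordinary, `μ`-ordinary shape) local Galois representation.**
`ρ : Γ_L → GL_n(A)` is `P`-ordinary of type `(blk, w)` — `blk : Fin n → α` a block labelling
into a linear order (blocks = fibres of `blk`, least label = subobject), `w : α → ι → ℤ` labelled
Hodge–Tate weights per block and per embedding `emb i : L →+* A` — with respect to the local Artin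
datum `d`, if there are a frame `Q ∈ GL_n(A)` and an open subgroup `U ≤ Γ_L` such that
(1) every `Q⁻¹ ρ(σ) Q` is block upper triangular (`Matrix.BlockTriangular … blk`), and
(2) for every label `k` and every `x` in the inertia group `I_L ⊆ W_L` whose image in `Γ_L` lies
in `U`, the `k`-th diagonal block of `Q⁻¹ ρ(x) Q` is the scalar matrix
`∏_i (emb i)(artin x)^{-(w k i)}` (`LocalArtinData.weightCharacter d emb (-w k)`): the block
acts on an open subgroup of inertia through `∏_τ (τ ∘ Art_L⁻¹)^{-w_{k,τ}}`.
For blocks of size one and `A = ℚ̄_ℓ` this is conditions (1)–(2) of BLGGT's *ordinary* with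
`b_{τ,i} = -w` (their regularity ordering `b_{τ,1} < ⋯ < b_{τ,n}` and any distinguishedness are
not included); BCGP's "`p`-distinguished weight 2 ordinary" representations are `P`-ordinary of
type (blocks `(2,2)`, parallel weights `0, 1`).  Convention: `HT(ε) = -1`, so a block of parallel
weight `w` acts on an open subgroup of inertia through `ε^{-w}`.
[cite: BarnetlambEtAl2014, §1.4 (definition of ordinary)] [cite: BoxerEtAl2021, §7.3, first Definition (p-distinguished weight 2 ordinary)] -/
def IsPOrdinary (ρ : FramedGaloisRep L A n) (d : LocalArtinData L) (blk : Fin n → α)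
    (emb : ι → L →+* A) (w : α → ι → ℤ) : Prop :=
  ∃ (Q : GL (Fin n) A) (U : Subgroup (absoluteGaloisGroup L)),
    IsOpen (U : Set (absoluteGaloisGroup L)) ∧
    (∀ σ : absoluteGaloisGroup L, (Q⁻¹ * ρ σ * Q).val.BlockTriangular blk) ∧
    ∀ (k : α), ∀ x ∈ WeilGroup.inertia L, WeilGroup.toAbsGalois L x ∈ U →
      (Q⁻¹ * ρ (WeilGroup.toAbsGalois L x) * Q).val.toSquareBlock blk k =
        ((d.weightCharacter emb (-w k) x : Aˣ) : A) •
          (1 : Matrix {a // blk a = k} {a // blk a = k} A)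

/-- Unfolding lemma for `IsPOrdinary`. [folklore] -/
theorem isPOrdinary_iff (ρ : FramedGaloisRep L A n) (d : LocalArtinData L) (blk : Fin n → α)
    (emb : ι → L →+* A) (w : α → ι → ℤ) :
    ρ.IsPOrdinary d blk emb w ↔
      ∃ (Q : GL (Fin n) A) (U : Subgroup (absoluteGaloisGroup L)),
        IsOpen (U : Set (absoluteGaloisGroup L)) ∧
        (∀ σ : absoluteGaloisGroup L, (Q⁻¹ * ρ σ * Q).val.BlockTriangular blk) ∧
        ∀ (k : α), ∀ x ∈ WeilGroup.inertia L, WeilGroup.toAbsGalois L x ∈ U →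
          (Q⁻¹ * ρ (WeilGroup.toAbsGalois L x) * Q).val.toSquareBlock blk k =
            ((d.weightCharacter emb (-w k) x : Aˣ) : A) •
              (1 : Matrix {a // blk a = k} {a // blk a = k} A) :=
  Iff.rfl

/-- `P`-ordinarity is independent of the frame: invariant under `ρ ↦ P ρ P⁻¹` (`FramedRep.conj`),
the frame `Q` being replaced by `P Q`. [folklore] -/
theorem isPOrdinary_conj_iff [IsTopologicalRing A] (P : GL (Fin n) A) (ρ : FramedGaloisRep L A n)
    (d : LocalArtinData L) (blk : Fin n → α) (emb : ι → L →+* A) (w : α → ι → ℤ) :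
    IsPOrdinary (FramedRep.conj P ρ) d blk emb w ↔ ρ.IsPOrdinary d blk emb w := by
  constructor
  · rintro ⟨Q, U, hU, hbt, hin⟩
    refine ⟨P⁻¹ * Q, U, hU, fun σ => ?_, fun k x hx hxU => ?_⟩
    · have e : (P⁻¹ * Q)⁻¹ * ρ σ * (P⁻¹ * Q) = Q⁻¹ * FramedRep.conj P ρ σ * Q := by
        rw [FramedRep.conj_apply]; group
      rw [e]
      exact hbt σ
    · have e : (P⁻¹ * Q)⁻¹ * ρ (WeilGroup.toAbsGalois L x) * (P⁻¹ * Q) =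
          Q⁻¹ * FramedRep.conj P ρ (WeilGroup.toAbsGalois L x) * Q := by
        rw [FramedRep.conj_apply]; group
      rw [e]
      exact hin k x hx hxU
  · rintro ⟨Q, U, hU, hbt, hin⟩
    refine ⟨P * Q, U, hU, fun σ => ?_, fun k x hx hxU => ?_⟩
    · have e : (P * Q)⁻¹ * FramedRep.conj P ρ σ * (P * Q) = Q⁻¹ * ρ σ * Q := by
        rw [FramedRep.conj_apply]; group
      rw [e]
      exact hbt σ
    · have e : (P * Q)⁻¹ * FramedRep.conj P ρ (WeilGroup.toAbsGalois L x) * (P * Q) =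
          Q⁻¹ * ρ (WeilGroup.toAbsGalois L x) * Q := by
        rw [FramedRep.conj_apply]; group
      rw [e]
      exact hin k x hx hxU

/-- The open subgroup in `IsPOrdinary` may be shrunk: the definition is equivalent to asking the
inertial condition on *some* open subgroup contained in any prescribed open subgroup `V`. [folklore] -/
theorem IsPOrdinary.exists_le {ρ : FramedGaloisRep L A n} {d : LocalArtinData L}
    {blk : Fin n → α} {emb : ι → L →+* A} {w : α → ι → ℤ} (h : ρ.IsPOrdinary d blk emb w)
    (V : Subgroup (absoluteGaloisGroup L)) (hV : IsOpen (V : Set (absoluteGaloisGroup L))) :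
    ∃ (Q : GL (Fin n) A) (U : Subgroup (absoluteGaloisGroup L)), U ≤ V ∧
      IsOpen (U : Set (absoluteGaloisGroup L)) ∧
      (∀ σ : absoluteGaloisGroup L, (Q⁻¹ * ρ σ * Q).val.BlockTriangular blk) ∧
      ∀ (k : α), ∀ x ∈ WeilGroup.inertia L, WeilGroup.toAbsGalois L x ∈ U →
        (Q⁻¹ * ρ (WeilGroup.toAbsGalois L x) * Q).val.toSquareBlock blk k =
          ((d.weightCharacter emb (-w k) x : Aˣ) : A) •
            (1 : Matrix {a // blk a = k} {a // blk a = k} A) := by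
  obtain ⟨Q, U, hU, hbt, hin⟩ := h
  exact ⟨Q, U ⊓ V, inf_le_right, hU.inter hV, hbt,
    fun k x hx hxU => hin k x hx (Subgroup.mem_inf.mp hxU).1⟩

/-- Sanity check (non-vacuity): the trivial representation `1 : Γ_L → GL_n(A)` is `P`-ordinary of
weight `0` for every block labelling, every family of embeddings and every Artin datum (frame
`Q = 1`, `U = ⊤`).  Mathematically: the trivial representation is crystalline with all Hodge–Tate
weights `0`. [folklore] -/
theorem isPOrdinary_one (d : LocalArtinData L) (blk : Fin n → α) (emb : ι → L →+* A) :
    IsPOrdinary (1 : FramedGaloisRep L A n) d blk emb 0 := by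
  refine ⟨1, ⊤, isOpen_univ, fun σ => ?_, fun k x _ _ => ?_⟩
  · simpa using Matrix.blockTriangular_one
  · have h0 : -(0 : α → ι → ℤ) k = 0 := by simp
    rw [h0, LocalArtinData.weightCharacter_zero]
    ext i j
    simp [Matrix.toSquareBlock_def, Matrix.one_apply, Subtype.ext_iff]

end FramedGaloisRep

end Local

/-! ### `P`-ordinary at a finite place of a number field -/

section Global

variable {K : Type*} [Field K] [NumberField K]
variable {A : Type*} [CommRing A] [TopologicalSpace A]
variable {n : ℕ} {α : Type*} [LinearOrder α] {ι : Type*} [Fintype ι]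

namespace FramedGaloisRep

/-- **`P`-ordinary at `v`.**  A framed Galois representation `ρ : Γ_K → GL_n(A)` of the number
field `K` is `P`-ordinary at the finite place `v` of type `(blk, w)` (block labelling
`blk : Fin n → α`, labelled Hodge–Tate weights `w : α → ι → ℤ` for the embeddings
`emb i : K_v →+* A`), with respect to the local Artin datum `d` of `K_v = v.adicCompletion K`, if
its restriction `ρ.toLocal v : Γ_{K_v} → GL_n(A)` to the decomposition group is `P`-ordinary of
that type (`FramedGaloisRep.IsPOrdinary`): in some frame `ρ|_{Γ_{K_v}}` is block upper triangular
and its `k`-th diagonal block acts on an open subgroup of the inertia group through the scalar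
character `∏_i (emb i ∘ Art_{K_v}⁻¹)^{-w k i}`.  Intended for `v ∣ ℓ`, `A` an `ℓ`-adic coefficient
ring and `emb` an enumeration of the (continuous) embeddings `K_v ↪ ℚ̄_ℓ`; e.g. the `μ`-ordinary
type of `GU(4,1)` at a prime with `[K_v : ℚ_ℓ] = 2`: `blk = ![0,1,1,1,2]`, `w = ![![0,0],![1,0],![1,1]]`.
[cite: BarnetlambEtAl2014, §1.4 (definition of ordinary)] [cite: BoxerEtAl2021, §7.3, first Definition (p-distinguished weight 2 ordinary)] -/
def IsPOrdinaryAt (ρ : FramedGaloisRep K A n) (v : HeightOneSpectrum (𝓞 K))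
    (d : LocalArtinData (v.adicCompletion K)) (blk : Fin n → α)
    (emb : ι → v.adicCompletion K →+* A) (w : α → ι → ℤ) : Prop :=
  IsPOrdinary (ρ.toLocal v) d blk emb w

/-- Unfolding lemma for `IsPOrdinaryAt` (through `IsPOrdinary` of `ρ.toLocal v`). [folklore] -/
theorem isPOrdinaryAt_iff (ρ : FramedGaloisRep K A n) (v : HeightOneSpectrum (𝓞 K))
    (d : LocalArtinData (v.adicCompletion K)) (blk : Fin n → α)
    (emb : ι → v.adicCompletion K →+* A) (w : α → ι → ℤ) :
    ρ.IsPOrdinaryAt v d blk emb w ↔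
      ∃ (Q : GL (Fin n) A) (U : Subgroup (absoluteGaloisGroup (v.adicCompletion K))),
        IsOpen (U : Set (absoluteGaloisGroup (v.adicCompletion K))) ∧
        (∀ σ, (Q⁻¹ * ρ.toLocal v σ * Q).val.BlockTriangular blk) ∧
        ∀ (k : α), ∀ x ∈ WeilGroup.inertia (v.adicCompletion K),
          WeilGroup.toAbsGalois (v.adicCompletion K) x ∈ U →
          (Q⁻¹ * ρ.toLocal v (WeilGroup.toAbsGalois (v.adicCompletion K) x) * Q).val.toSquareBlock
              blk k =
            ((d.weightCharacter emb (-w k) x : Aˣ) : A) •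
              (1 : Matrix {a // blk a = k} {a // blk a = k} A) :=
  Iff.rfl

/-- `P`-ordinarity at `v` is invariant under change of frame `ρ ↦ P ρ P⁻¹`. [folklore] -/
theorem isPOrdinaryAt_conj_iff [IsTopologicalRing A] (P : GL (Fin n) A) (ρ : FramedGaloisRep K A n)
    (v : HeightOneSpectrum (𝓞 K)) (d : LocalArtinData (v.adicCompletion K)) (blk : Fin n → α)
    (emb : ι → v.adicCompletion K →+* A) (w : α → ι → ℤ) :
    IsPOrdinaryAt (FramedRep.conj P ρ) v d blk emb w ↔ ρ.IsPOrdinaryAt v d blk emb w := by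
  have e : FramedGaloisRep.toLocal v (FramedRep.conj P ρ) = FramedRep.conj P (ρ.toLocal v) :=
    ContinuousMonoidHom.ext fun _ => rfl
  rw [IsPOrdinaryAt, e]
  exact isPOrdinary_conj_iff P (ρ.toLocal v) d blk emb w

/-- The trivial representation of `Γ_K` is `P`-ordinary of weight `0` at every finite place. [folklore] -/
theorem isPOrdinaryAt_one (v : HeightOneSpectrum (𝓞 K)) (d : LocalArtinData (v.adicCompletion K))
    (blk : Fin n → α) (emb : ι → v.adicCompletion K →+* A) :
    IsPOrdinaryAt (1 : FramedGaloisRep K A n) v d blk emb 0 :=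
  isPOrdinary_one d blk emb

end FramedGaloisRep

end Global

end Literature.NumberTheory.GaloisRepresentations
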